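import Mathlib

/-!
# TRIAGE r1 seat 1 (gen 5) — kernel evidence for the verdict lines on the two «Greenberg on the
cyclotomic line» cards `greenberg-first-exchange` (gfe) and `greenberg-wronskian-reciprocity` (gwr)
in `TRIAGE-r1-1.md`, Gen-5 addendum

crux stmt-BirchSwinnertonDyer-19875 `SprungLowerDivisibilityAtThree`; seat refuter-cruxtriage-…-r1-1 (g5, 2026-08-28).
Evidence only: abstract commutative-domain algebra (`R` = `Λ^ur` or `Λ^ur[1/3]` on the cyclotomic line
`K^cyc_∞`). NO idea verdict is a theorem of this file; BSD / K1 / the X8 leaf are NOT proved here.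

Dictionary (both cards, p = v v̄ split in K, a₃(E^K) = a₃(E), same Coleman matrix at v̄ ≅ ℚ₃):
* `D`  = 𝔇 = L♯_E·L♭_{E^K} − L♭_E·L♯_{E^K}`  (♯/♭ Coleman Wronskian of the Kato pair);
* `δ`  = δ₀ = char coker((Col♯, Col♭) : H¹_Iw(ℚ_{3,∞}, T) → Λ²)  (gfe keeps it symbolic; gwr sets δ₀ = T);
* `X`  = char X_{rel v, str v̄}(E/K^cyc_∞)  (gfe `xGr`, gwr `X`);
* `jE, jK` = char(𝐇¹/Λz) for E, E^K (gfe `hE, hK`);  `x0E, x0K` = char X_str (gfe `xE, xK`);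
* `gE, gK` = char X^col (gwr `gL, gL'`);  `LE, LK` = L^col (gwr `L, L'`);  `mE, mK` = Kato cofactors
  (`jE = x0E·mE`, Kato 2004 Thm 12.5: `x0 ∣ j`; gwr `a, b` with `L = gL·a`);
* `G` = G⁺ = cycRestrict 𝓛^Gr_v̄(E/K);  `gr : c·X = G·t` = descended Eisenstein (BSTW 9.24-type) bound
  `G ∣ c·X` with control factor `c`;  `wr : δ·G = D·e` = (WR)/(W) with comparison cofactor `e`
  (gwr's sharp (W) is the case `e` a unit and `δ = T`).

Findings recorded here (see the Gen-5 addendum for the prose):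
(1) `fourTerm_iff_star` — gfe's Poitou–Tate four-term identity `𝔇·x0E·x0K = δ₀·jE·jK·X` and gwr's (★)
    `X·L_E·L_K = (𝔇/δ₀)·gE·gK` are THE SAME identity modulo Sprung 2012 Thm 7.14 (3)
    (`jE·gE = LE·x0E`, alternating product of `0 → 𝐇¹/Z → Λ/(L^col) → X^col → X^0 → 0`): same lever.
(2) `exchange_identity` — (PT) + (Kato cofactors) + (GR) already give `D·c = δ·G·(mE·mK·t)` with NO new
    input; hence (`control_eq_of_wr`) under 𝔇 ≠ 0 the new axiom (WR) `δ·G = D·e` is EQUIVALENT to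
    `c = mE·mK·e·t`: on the locus where the control factor `c` is a unit, (WR) holds iff Kato's MC for E,
    Kato's MC for E^K, equality in the descended Greenberg bound AND sharpness of (WR) all hold
    (`units_of_wr`, `wr_of_mainConjectures`). So (WR)/(W) is not weaker than the crux: its only
    «why easier» is methodological (an identity of two analytic functions, to be proved by reciprocity
    laws) — the pricing consequence is in the triage note, not here.
(3) `wronskian_const_term` — at `T = 0` both Coleman value vectors lie on ONE line (tree SANITY note in
    `Literature/…/Sprung2012/ColemanMapImage.lean`: the joint map `(Col♯, Col♭)` is NOT surjective, image
    mod `T` = the line through `(a_p(a_p−2)−(p−1), a_p−2)`), so `𝔇(0) = 0` identically and `T ∣ δ₀ ∣ 𝔇`: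
    gwr's normalisation `𝔇/T` is legitimate iff `δ₀ ≐ T` exactly (cyclic cokernel: the direction vector is
    primitive at `(3, ±3)`, `gcd_dir_plus/minus`), which neither card types — a one-line stub.
(4) `noThreeTorsion_X8` — `#Ẽ(𝔽₃) = 4 ∓ 3 ∈ {1, 7}` is prime to 3, the input for `E(K^cyc_∞)[3] = 0`
    (torsion-free `H¹_Iw`, exact control) used by both cards.

`lean check`: rc 0 expected, 0 sorries; axioms ⊆ {propext, Classical.choice, Quot.sound}.
-/

set_option linter.dupNamespace false

namespace Summit.BirchSwinnertonDyer.BirchSwinnertonDyer.Cruxes.SprungLowerDivisibilityAtThree.TriageR11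

namespace GreenbergExchange

variable {R : Type*} [CommRing R] [IsDomain R]

/-- (1) The two cards' load-bearing identities coincide: given Sprung 2012 Thm 7.14 (3) for each curve
(`seqE`, `seqK`), gfe's four-term identity ↔ gwr's (★) (cleared of the denominator `δ₀`). -/
theorem fourTerm_iff_star {D δ X jE jK x0E x0K gE gK LE LK : R}
    (hx0E : x0E ≠ 0) (hx0K : x0K ≠ 0) (hgE : gE ≠ 0) (hgK : gK ≠ 0)
    (seqE : jE * gE = LE * x0E) (seqK : jK * gK = LK * x0K) :
    D * (x0E * x0K) = δ * (jE * jK) * X ↔ δ * (X * LE * LK) = D * (gE * gK) := by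
  constructor
  · intro four
    have h : x0E * x0K * (δ * (X * LE * LK)) = x0E * x0K * (D * (gE * gK)) := by
      linear_combination (-(gE * gK)) * four - (δ * X * jK * gK) * seqE - (δ * X * LE * x0E) * seqK
    exact mul_left_cancel₀ (mul_ne_zero hx0E hx0K) h
  · intro star
    have h : gE * gK * (D * (x0E * x0K)) = gE * gK * (δ * (jE * jK) * X) := by
      linear_combination (-(x0E * x0K)) * star - (δ * X * jK * gK) * seqE - (δ * X * LE * x0E) * seqK
    exact mul_left_cancel₀ (mul_ne_zero hgE hgK) h

/-- (2a) The Wronskian in terms of the mixed characteristic series: (PT) + Kato cofactors give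
`𝔇 = δ₀·mE·mK·X` — no (WR), no Greenberg input. -/
theorem wronskian_eq {D δ X jE jK x0E x0K mE mK : R} (hx0E : x0E ≠ 0) (hx0K : x0K ≠ 0)
    (four : D * (x0E * x0K) = δ * (jE * jK) * X) (katoE : jE = x0E * mE) (katoK : jK = x0K * mK) :
    D = δ * mE * mK * X := by
  subst katoE katoK
  have h : x0E * x0K * D = x0E * x0K * (δ * mE * mK * X) := by linear_combination four
  exact mul_left_cancel₀ (mul_ne_zero hx0E hx0K) h

/-- (2b) EXCHANGE IDENTITY: (PT) + Kato cofactors + the descended Greenberg bound `c·X = G·t` already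
give `𝔇·c = δ₀·G⁺·(mE·mK·t)`. Everything the new axiom (WR) can add is a statement about `c`. -/
theorem exchange_identity {D δ X jE jK x0E x0K mE mK G c t : R} (hx0E : x0E ≠ 0) (hx0K : x0K ≠ 0)
    (four : D * (x0E * x0K) = δ * (jE * jK) * X) (katoE : jE = x0E * mE) (katoK : jK = x0K * mK)
    (gr : c * X = G * t) : D * c = δ * G * (mE * mK * t) := by
  have hD := wronskian_eq hx0E hx0K four katoE katoK
  linear_combination c * hD + (δ * mE * mK) * gr

/-- (2c) Under non-degeneracy `𝔇 ≠ 0` (gfe S6 / gwr (NV)), (WR) `δ₀·G⁺ = 𝔇·e` pins the control factor: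
`c = mE·mK·e·t`. -/
theorem control_eq_of_wr {D δ X jE jK x0E x0K mE mK G c t e : R} (hD : D ≠ 0)
    (hx0E : x0E ≠ 0) (hx0K : x0K ≠ 0)
    (four : D * (x0E * x0K) = δ * (jE * jK) * X) (katoE : jE = x0E * mE) (katoK : jK = x0K * mK)
    (gr : c * X = G * t) (wr : δ * G = D * e) : c = mE * mK * e * t := by
  have hx := exchange_identity hx0E hx0K four katoE katoK gr
  have h : D * c = D * (mE * mK * e * t) := by linear_combination hx + (mE * mK * t) * wr
  exact mul_left_cancel₀ hD h

/-- (2d) Consequently, where the control factor is a unit, (WR) forces ALL FOUR of: Kato's main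
conjecture for `E` (`mE` unit), for `E^K` (`mK` unit), sharpness of (WR) (`e` unit) and equality in
the descended Greenberg bound (`t` unit). (WR) is as strong as the conjunction — not a weakening. -/
theorem units_of_wr {D δ X jE jK x0E x0K mE mK G c t e : R} (hD : D ≠ 0)
    (hx0E : x0E ≠ 0) (hx0K : x0K ≠ 0)
    (four : D * (x0E * x0K) = δ * (jE * jK) * X) (katoE : jE = x0E * mE) (katoK : jK = x0K * mK)
    (gr : c * X = G * t) (wr : δ * G = D * e) (hc : IsUnit c) :
    IsUnit mE ∧ IsUnit mK ∧ IsUnit e ∧ IsUnit t := by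
  have h := control_eq_of_wr hD hx0E hx0K four katoE katoK gr wr
  rw [h] at hc
  -- hc : IsUnit (mE * mK * e * t)
  have h1 : IsUnit (mE * mK * e) ∧ IsUnit t := IsUnit.mul_iff.mp hc
  have h2 : IsUnit (mE * mK) ∧ IsUnit e := IsUnit.mul_iff.mp h1.1
  have h3 : IsUnit mE ∧ IsUnit mK := IsUnit.mul_iff.mp h2.1
  exact ⟨h3.1, h3.2, h2.2, h1.2⟩

/-- (2e) Converse: Kato's MC for `E` and `E^K` plus equality (up to the unit `t`) in the descended
Greenberg bound GIVE (WR), with comparison cofactor `e = c·u⁻¹`, a unit iff `c` is. So, modulo the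
binder and the control factor, (WR) ⟺ [Kato MC(E) ∧ Kato MC(E^K) ∧ cyclotomic-line Greenberg MC]. -/
theorem wr_of_mainConjectures {D δ X jE jK x0E x0K mE mK G c t : R} (hx0E : x0E ≠ 0) (hx0K : x0K ≠ 0)
    (four : D * (x0E * x0K) = δ * (jE * jK) * X) (katoE : jE = x0E * mE) (katoK : jK = x0K * mK)
    (gr : c * X = G * t) (hu : IsUnit (mE * mK * t)) :
    ∃ e : R, δ * G = D * e ∧ (IsUnit e ↔ IsUnit c) := by
  obtain ⟨u, hu'⟩ := hu
  have hx := exchange_identity hx0E hx0K four katoE katoK gr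
  refine ⟨c * ↑u⁻¹, ?_, ?_⟩
  · have key : δ * G * ↑u = D * c := by rw [hu']; linear_combination -hx
    calc δ * G = δ * G * ↑u * ↑u⁻¹ := by rw [Units.mul_inv_cancel_right]
      _ = D * (c * ↑u⁻¹) := by rw [key]; ring
  · constructor
    · intro he
      have : IsUnit (c * ↑u⁻¹ * ↑u) := he.mul (Units.isUnit u)
      simpa using this
    · intro hc
      exact hc.mul (Units.isUnit u⁻¹)

/-- (3) `𝔇(0) = 0`: two vectors on one line have zero determinant (`T ∣ 𝔇`; with the cyclic cokernel,
`T ∣ δ₀ ∣ 𝔇`). Here `(sE, fE) = λ•(v₁, v₂)` and `(sK, fK) = μ•(v₁, v₂)` are the `T = 0` values of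
`(L♯, L♭)` for `E` and `E^K`. -/
theorem wronskian_const_term {S : Type*} [CommRing S] {sE fE sK fK v₁ v₂ lam mu : S}
    (hE₁ : sE = lam * v₁) (hE₂ : fE = lam * v₂) (hK₁ : sK = mu * v₁) (hK₂ : fK = mu * v₂) :
    sE * fK - fE * sK = 0 := by
  subst hE₁ hE₂ hK₁ hK₂; ring

/-- The direction vector `(a_p(a_p − 2) − (p − 1), a_p − 2)` of the joint Coleman image mod `T`
(tree SANITY note, `Sprung2012/ColemanMapImage.lean`) at `(p, a_p) = (3, 3)` is `(1, 1)` … -/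
theorem dir_plus : ((3 : ℤ) * (3 - 2) - (3 - 1), (3 : ℤ) - 2) = (1, 1) := by norm_num

/-- … and at `(3, −3)` it is `(13, −5)`; both are PRIMITIVE, so the cokernel mod `T` is exactly `ℤ₃`
(cyclic cokernel `Λ/(δ₀)` with `T ∣ δ₀`). -/
theorem dir_minus : ((-3 : ℤ) * (-3 - 2) - (3 - 1), (-3 : ℤ) - 2) = (13, -5) := by norm_num

theorem gcd_dir_plus : Int.gcd 1 1 = 1 := by decide

theorem gcd_dir_minus : Int.gcd 13 (-5) = 1 := by decide

/-- (4) On X8 (`p = 3`, `a₃ = ±3`): `#Ẽ(𝔽₃) = p + 1 − a_p ∈ {1, 7}` is prime to `3` — the source of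
`E(ℚ)[3] = 0` (reduction is injective on torsion at a good prime with `e = 1 < p − 1`) and hence of
`E(K^cyc_∞)[3] = 0` (pro-3 group acting), used by both cards for torsion-free `H¹_Iw` and exact control. -/
theorem noThreeTorsion_X8 : ¬ (3 ∣ (3 + 1 - 3 : ℤ)) ∧ ¬ (3 ∣ (3 + 1 + 3 : ℤ)) := by decide

/-- (4') Heegner parity for gwr's population R1 (all `ℓ ∣ N⁺` split, the `ν` primes of `N⁻` inert,
`(N, D_K) = 1`, `N` square-free): `w(E/K) = −(−1)^ν`, so `w(E/K) = −1` iff `ν` is even — recorded as the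
parity fact it is. -/
theorem heegner_sign_even (ν : ℕ) : (-(-1 : ℤ) ^ ν = -1) ↔ Even ν := by
  rw [neg_inj]
  rcases Nat.even_or_odd ν with h | h
  · simp [h.neg_one_pow, h]
  · simp [h.neg_one_pow, Nat.not_even_iff_odd.mpr h]

end GreenbergExchange

end Summit.BirchSwinnertonDyer.BirchSwinnertonDyer.Cruxes.SprungLowerDivisibilityAtThree.TriageR11
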